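/-
Copyright: statement-level skeleton of a published paper (lit-balaban cell, Phase-2 proof seat p18, gen 7). No claims beyond
what the kernel checks below.
-/
import Mathlib
import Literature.MathematicalPhysics.QuantumFieldTheory.Balaban1983to89.B3Prop22FreeLines
import Literature.MathematicalPhysics.QuantumFieldTheory.Balaban1983to89.B3Prop21Except24Member

/-!
# B3 — T. Bałaban, *(Higgs)₂,₃ quantum fields in a finite volume. III. Renormalization*, CMP **88** (1983) 411–445
[Balaban1983Higgs3] — Proposition 2.2 p. 428: a WORKED MEMBER of the family of generalized graphs — the graph (2.4) with its
line of standard dimension (hypothesis met through the exception) and with the dimension raised by `1 + α` as in (3.12)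
(hypothesis met through positivity)

statement-level skeleton of published theorems with citation tags; proofs where landed; nothing here is a claim about
the Yang–Mills mass gap

PDF held: `paper:balaban1983-higgs-2-3-quantum-fields-finite-volume` (journal page = PDF page + 410).

Part of the Phase-2 work on SKELETON row **B3.Prop2.2** (unit `lit-balaban-p18` gen 7, HOME `run/shared/lean/pub/lit-balaban/`;
closing item «free line exponent κ_l»): example file next to `B3Prop22FreeLines` (`prop22_freeLines : Prop22 (famK P mbar)`),
using seat p19's worked datum `graph24` (`B3Prop21Except24Example`, `B3Prop21Except24Member`).

WHAT IS REPRODUCED.  p. 424 [PDF 14]: *"let us introduce the following special graph with a degree equal to 0: (2.4)"*;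
p. 436 [PDF 26]: *"the factor |x − x′|^{1+α} adds to the degree of the graph the number 1 + α, thus the degree of the
expression is equal to −d + 3 + α now … so we will represent graphically this expression by the generalized graph (3.12)"*.
KERNEL-CHECKED HERE, for the menu `{0, 3/2}` of extra line dimensions (`3/2 = 1 + α` at `α = ½`, the choice *"e.g. if we take
α₀ = ½"* of p. 421): the count datum `graph24` of (2.4) IS a generalized graph of the family `famK` in two ways —
`memberK24 0` (standard line: its only block is the (2.4)-block, degree `0`, and r15's PRINTED hypothesis
`PosSubgraphsExcept24` holds THROUGH THE EXCEPTION `Is24K`, `posSubgraphsExcept24_memberK24_zero`, while plain positivity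
fails, `not_posSubgraphs_memberK24_zero`) and `memberK24 (3/2)` (the line dimension raised by `1 + α`: the block degree becomes
`3/2 > 0`, `degQK_graph24_shift`, so the hypothesis holds THROUGH POSITIVITY and the block is no longer exceptional,
`posSubgraphsExcept24_memberK24_shift`, `not_is24K_graph24_shift`).  Hence `prop22_freeLines` asserts (1.33) for the
amplitudes of both generalized graphs; nothing here is vacuous.
-/

open Finset

namespace Literature.MathematicalPhysics.QuantumFieldTheory.Balaban1983to89

namespace B3FreeLine

open B3Ineq215 B3Ineq213 B3Sect2FirstEstimate B3Prop1

/-- The constants of the example family: those of p19's `params24` (`d = 3`, `L = 2`, `δ₁ = 1`, bounds `Cmax`, `CD`) and the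
menu `{0, 3/2}` of extra line dimensions (`3/2 = 1 + α`, `α = ½`). [cite: Balaban1983Higgs3, Prop. 2.2 p.428] -/
def paramsK24 (Cmax CD : ℝ) : ParamsK where
  toParamsIBP := params24 Cmax CD
  menu := {0, 3 / 2}

/-- **(2.4) with the extra line dimension `κ₀ ∈ {0, 3/2}` is a generalized graph of the family** at every size bound `mb ≥ 1`.
[cite: Balaban1983Higgs3, Prop. 2.2 p.428] -/
noncomputable def memberK24 (Cmax CD : ℝ) {mb : ℕ} (h : 1 ≤ mb) (κ₀ : ℚ) (hκ : κ₀ ∈ (paramsK24 Cmax CD).menu) :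
    CGraphK (paramsK24 Cmax CD) mb where
  toCGraphC := member24 Cmax CD h
  κ := fun _ => κ₀
  κ_mem := fun _ => hκ

/-- `0` is on the menu. [cite: Balaban1983Higgs3, Prop. 2.2 p.428] -/
theorem zero_mem_menu24 (Cmax CD : ℝ) : (0 : ℚ) ∈ (paramsK24 Cmax CD).menu := by
  simp [paramsK24]

/-- `3/2` is on the menu. [cite: Balaban1983Higgs3, Prop. 2.2 p.428] -/
theorem shift_mem_menu24 (Cmax CD : ℝ) : (3 / 2 : ℚ) ∈ (paramsK24 Cmax CD).menu := by
  simp [paramsK24]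

/-! ## The degrees of the only block in the two readings -/

/-- With the standard line the block of (2.4) keeps degree `0`. [cite: Balaban1983Higgs3, (2.4) p.424] -/
theorem degQK_graph24_zero : degQK graph24 (fun _ => (0 : ℚ)) 1 0 = 0 := by
  unfold degQK
  rw [degQ_graph24, before_one_graph24]
  simp

/-- **The line dimension raised by `1 + α = 3/2` raises the degree of (2.4) to `3/2`** (*"adds to the degree of the graph the
number 1 + α"*). [cite: Balaban1983Higgs3, (3.12) p.436] -/
theorem degQK_graph24_shift : degQK graph24 (fun _ => (3 / 2 : ℚ)) 1 0 = 3 / 2 := by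
  unfold degQK
  rw [degQ_graph24, before_one_graph24]
  simp

/-- With the standard line the block is a (2.4)-block of the generalized graph. [cite: Balaban1983Higgs3, (2.4) p.424] -/
theorem is24K_graph24_zero : Is24K graph24 (fun _ => (0 : ℚ)) 1 0 :=
  ⟨is24Block_graph24, fun _ _ => rfl⟩

/-- With the raised line dimension the block is NOT a (2.4)-block of the generalized graph (its line is not a standard one).
[cite: Balaban1983Higgs3, (3.12) p.436] -/
theorem not_is24K_graph24_shift : ¬ Is24K graph24 (fun _ => (3 / 2 : ℚ)) 1 0 := by
  rintro ⟨-, h⟩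
  have h0 := h 0 (by rw [before_one_graph24]; exact mem_singleton_self _)
  norm_num at h0

/-! ## The printed hypothesis for the two members -/

/-- The components of a one-line graph: only the block of `G₁ = G` (index `1`, representative `0`) is non-trivial.
[cite: Balaban1983Higgs3, Prop. 2.1 p.424] -/
theorem block_graph24 {σ : Equiv.Perm (Fin 1)} {i : Fin 2} {b : Fin 2}
    (hb : b ∈ (relabelCounts graph24 σ).toModel.reps (i : ℕ)) (hn : (relabelCounts graph24 σ).toModel.Nontriv (i : ℕ) b) :
    (i : ℕ) = 1 ∧ b = 0 := by
  rw [relabelCounts_graph24] at hb hn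
  have hi : (i : ℕ) = 0 ∨ (i : ℕ) = 1 := by have := i.isLt; omega
  rcases hi with hi | hi
  · rw [hi] at hn
    exact absurd hn (by simp [Model.Nontriv, Model.before_zero])
  · refine ⟨hi, ?_⟩
    rw [hi] at hb
    have := graph24.toModel.mem_reps.1 hb
    rw [rep_one_graph24] at this
    exact this.symm

/-- **The PRINTED hypothesis of Proposition 2.1 holds for (2.4) with its standard line** in the generalized family — through
the exception clause `Is24 := Is24K`. [cite: Balaban1983Higgs3, Prop. 2.1 p.424] -/
theorem posSubgraphsExcept24_memberK24_zero (Cmax CD : ℝ) {mb : ℕ} (h : 1 ≤ mb) (D : DatumK (paramsK24 Cmax CD)) :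
    PosSubgraphsExcept24 (expansionK (paramsK24 Cmax CD) mb D) (memberK24 Cmax CD h 0 (zero_mem_menu24 Cmax CD)) := by
  refine ⟨trivial, ?_⟩
  show ∀ H : Component graph24,
    Is24K (relabelCounts graph24 H.1) ((fun _ => (0 : ℚ)) ∘ H.1) H.2.1 H.2.2.1
      ∨ 0 < degQK (relabelCounts graph24 H.1) ((fun _ => (0 : ℚ)) ∘ H.1) H.2.1 H.2.2.1
  rintro ⟨σ, i, b, hb, hn⟩
  left
  change Is24K (relabelCounts graph24 σ) ((fun _ => (0 : ℚ)) ∘ σ) i b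
  obtain ⟨hi, rfl⟩ := block_graph24 hb hn
  rw [relabelCounts_graph24, hi]
  exact is24K_graph24_zero

/-- … while plain positivity of all block degrees fails for it (the block has degree `0`). [cite: Balaban1983Higgs3, Prop. 2.1 p.424] -/
theorem not_posSubgraphs_memberK24_zero (Cmax CD : ℝ) {mb : ℕ} (h : 1 ≤ mb) (D : DatumK (paramsK24 Cmax CD)) :
    ¬ ∀ H : (expansionK (paramsK24 Cmax CD) mb D).Sub (memberK24 Cmax CD h 0 (zero_mem_menu24 Cmax CD)),
        0 < (expansionK (paramsK24 Cmax CD) mb D).subDeg (memberK24 Cmax CD h 0 (zero_mem_menu24 Cmax CD)) H := by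
  intro hall
  change ∀ H : Component graph24, 0 < degQK (relabelCounts graph24 H.1) ((fun _ => (0 : ℚ)) ∘ H.1) H.2.1 H.2.2.1 at hall
  have hrep : (0 : Fin 2) ∈ (relabelCounts graph24 1).toModel.reps ((1 : Fin 2) : ℕ) := by
    rw [relabelCounts_graph24, Model.mem_reps]; exact rep_one_graph24 0
  have hnt : (relabelCounts graph24 1).toModel.Nontriv ((1 : Fin 2) : ℕ) 0 := by
    rw [relabelCounts_graph24]; change (graph24.toModel.before 1 0).Nonempty
    rw [before_one_graph24]; exact singleton_nonempty 0
  have h1 := hall ⟨1, 1, 0, hrep, hnt⟩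
  change 0 < degQK (relabelCounts graph24 1) ((fun _ => (0 : ℚ)) ∘ (1 : Equiv.Perm (Fin 1))) ((1 : Fin 2) : ℕ) 0 at h1
  rw [relabelCounts_graph24, Fin.val_one] at h1
  have : degQK graph24 ((fun _ => (0 : ℚ)) ∘ (1 : Equiv.Perm (Fin 1))) 1 0 = degQK graph24 (fun _ => (0 : ℚ)) 1 0 := rfl
  rw [this, degQK_graph24_zero] at h1
  exact lt_irrefl 0 h1

/-- **With the line dimension raised by `1 + α` the PRINTED hypothesis holds through positivity** (degree `3/2 > 0`; the
block is not exceptional). [cite: Balaban1983Higgs3, Prop. 2.2 p.428] -/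
theorem posSubgraphsExcept24_memberK24_shift (Cmax CD : ℝ) {mb : ℕ} (h : 1 ≤ mb) (D : DatumK (paramsK24 Cmax CD)) :
    PosSubgraphsExcept24 (expansionK (paramsK24 Cmax CD) mb D) (memberK24 Cmax CD h (3 / 2) (shift_mem_menu24 Cmax CD)) := by
  refine ⟨trivial, ?_⟩
  show ∀ H : Component graph24,
    Is24K (relabelCounts graph24 H.1) ((fun _ => (3 / 2 : ℚ)) ∘ H.1) H.2.1 H.2.2.1
      ∨ 0 < degQK (relabelCounts graph24 H.1) ((fun _ => (3 / 2 : ℚ)) ∘ H.1) H.2.1 H.2.2.1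
  rintro ⟨σ, i, b, hb, hn⟩
  right
  change 0 < degQK (relabelCounts graph24 σ) ((fun _ => (3 / 2 : ℚ)) ∘ σ) i b
  obtain ⟨hi, rfl⟩ := block_graph24 hb hn
  rw [relabelCounts_graph24, hi]
  have : degQK graph24 ((fun _ => (3 / 2 : ℚ)) ∘ σ) 1 0 = degQK graph24 (fun _ => (3 / 2 : ℚ)) 1 0 := rfl
  rw [this, degQK_graph24_shift]
  norm_num

/-- For the raised member no block is exceptional: the hypothesis is met by positivity alone. [cite: Balaban1983Higgs3, Prop. 2.2 p.428] -/
theorem not_is24_memberK24_shift (Cmax CD : ℝ) {mb : ℕ} (h : 1 ≤ mb) (D : DatumK (paramsK24 Cmax CD)) :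
    ∀ H : (expansionK (paramsK24 Cmax CD) mb D).Sub (memberK24 Cmax CD h (3 / 2) (shift_mem_menu24 Cmax CD)),
      ¬ (expansionK (paramsK24 Cmax CD) mb D).Is24 (memberK24 Cmax CD h (3 / 2) (shift_mem_menu24 Cmax CD)) H := by
  show ∀ H : Component graph24, ¬ Is24K (relabelCounts graph24 H.1) ((fun _ => (3 / 2 : ℚ)) ∘ H.1) H.2.1 H.2.2.1
  rintro ⟨σ, i, b, hb, hn⟩
  change ¬ Is24K (relabelCounts graph24 σ) ((fun _ => (3 / 2 : ℚ)) ∘ σ) i b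
  obtain ⟨hi, rfl⟩ := block_graph24 hb hn
  rw [relabelCounts_graph24, hi]
  exact not_is24K_graph24_shift

/-- **(1.33) for both generalized members**, as asserted by `prop22_freeLines` (the constant `O(1)(n̄)` of the family at the
size bound): for every datum, every localization and all external-field data. [cite: Balaban1983Higgs3, Prop. 2.2 p.428] -/
theorem ineq133_memberK24 (Cmax CD : ℝ) (mbar : ℕ → ℕ) (nbar : ℕ) (h : 1 ≤ mbar nbar) (α₀ : ℝ) (h0 : 0 < α₀) (h1 : α₀ < 1) :
    ∃ δ₀ C : ℝ, 0 < δ₀ ∧ 0 < C ∧ ∀ D : DatumK (paramsK24 Cmax CD),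
      Ineq133At (famK (paramsK24 Cmax CD) mbar nbar D).toExpansion
          ((famK (paramsK24 Cmax CD) mbar nbar D).single (memberK24 Cmax CD h 0 (zero_mem_menu24 Cmax CD))) α₀ δ₀ C ∧
      Ineq133At (famK (paramsK24 Cmax CD) mbar nbar D).toExpansion
          ((famK (paramsK24 Cmax CD) mbar nbar D).single (memberK24 Cmax CD h (3 / 2) (shift_mem_menu24 Cmax CD))) α₀ δ₀ C := by
  obtain ⟨δ₀, hδ₀, H⟩ := prop21_freeLines (paramsK24 Cmax CD) mbar
  obtain ⟨C, hC, HC⟩ := H α₀ h0 h1 nbar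
  exact ⟨δ₀, C, hδ₀, hC, fun D => ⟨HC D _ (posSubgraphsExcept24_memberK24_zero Cmax CD h D),
    HC D _ (posSubgraphsExcept24_memberK24_shift Cmax CD h D)⟩⟩

end B3FreeLine

end Literature.MathematicalPhysics.QuantumFieldTheory.Balaban1983to89
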